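import Mathlib
import HarnessLib
import Summits.ResolutionOfSingularities.ResolutionOfSingularities.Theorems.WildQuotientsWildQuotientResolutionS1KillExitDefs
import Summits.ResolutionOfSingularities.ResolutionOfSingularities.Theorems.WildQuotientsWildQuotientResolutionS1KillExitDefsTame
import Summits.ResolutionOfSingularities.ResolutionOfSingularities.Theorems.WeightedInvariantDatumToEmbeddedQuotientSingularitiesSliceCore
import Literature.AlgebraicGeometry.RelativeSpec.FiniteGroupQuotientGluedProperties
import Literature.AlgebraicGeometry.Resolution.TameQuotientSingularitiesResolution

/-!
# `stub_tameToBR` of line B `s1a-tamebr` — REDUCED to one scheme-level statement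

[OURS · L1 W4.5c · idea-2 g15; filed by res-L1-w45c-stub-4 g5 per plan-1 RULING 2026-08-27T19:26:50Z / GO
19:38:21Z] — NOT statements of the manuscript; counted 0. Crux stmt-ResolutionOfSingularities-17941
(`WildQuotients.CyclicQuotientFourfolds`), line B (`s1a-tamebr`, CONDITIONAL twin of line L on the named fact
`BerghRydh2019_diagonalizableQuotientResolution`). Over the tree D2-T `…S1KillExitDefsTame`; companion of
`…S1aExitAssemblyBR` (`stub_exitAssemblyBR` proved). HELPER MODULE: the two remaining sorried statements
(`S1.TameBRExitCover`, `S1.InducedTorusStatement`) are DEFINED here as OURS `Prop`s and NOT asserted; they land as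
separate files when proved (`…S1aInducedTorus.lean` ⇒ `…S1aTameBRExitCover.lean`).

* `TameBRExitCover` — THE mathematical content of `stub_tameToBR`, isolated as ONE scheme-level statement with no
  group action in it: a scheme `Y` locally of finite type over a PERFECT field whose affine charts are tame root charts
  (`LocallyTameRootRegular Y`) carries a Bergh–Rydh exit cover (`BRExitCover k Y g`).
* `InducedTorusStatement` — (S1) typed target for provers: a tame root chart of finite type over the perfect field `k`
  is the degree-`0` part of a SMOOTH finite-type `ℤᵐ`-graded `k`-algebra with homogeneous units in all degrees
  `e • χ`, `e ≥ 1` (the input format of `exists_slice`). Intended proof of `TameBRExitCover`: (S1) + (S2) the tree's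
  PROVED Zariski–Luna slice `DatumToEmbedded.QuotientSingularities.exists_slice` + (S3) chart bookkeeping
  (closed points suffice; `IsAffineOpen.isoSpec`, `IsAffineOpen.SpecMap_appLE_fromSpec`, as in
  `TameQuotient.exists_tame_chart`).
* `globalKillBR_of_globalKillTame` — REAL PROOF of `stub_tameToBR` from `TameBRExitCover`: unpack the KILL-TAME
  model, keep `(V, π, ρB)` and the pin, and convert the exit conjunct on `V/G` with `g := r ≫ f`
  (`r = ρB.gluedDesc (π ≫ q) _` is proper by `ActionOver.isProper_gluedDesc`, so `g` is locally of finite type).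
* `stub_tameToBR_of (hE : TameBRExitCover)` — the skeleton's `stub_tameToBR` VERBATIM under the one hypothesis.
-/

set_option linter.dupNamespace false

noncomputable section

open CategoryTheory Limits AlgebraicGeometry TopologicalSpace
open Literature.AlgebraicGeometry.Resolution Literature.AlgebraicGeometry.RelativeSpec

namespace Summit.ResolutionOfSingularities.ResolutionOfSingularities.Theorems.WildQuotientResolution.S1.TameToBR

/-! ## The isolated content and the reduction -/

/-- **Tame root charts carry a Bergh–Rydh exit cover** (the content of `stub_tameToBR`, no group action left): for `k`
perfect and `g : Y → Spec k` locally of finite type, `LocallyTameRootRegular Y → BRExitCover k Y g`. Intended proof: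
(S1) induced torus + (S2) `exists_slice` + (S3) chart bookkeeping (module docstring). [OURS · L1 W4.5c] -/
def TameBRExitCover : Prop :=
  ∀ (k : Type) [Field k] [PerfectField k] (Y : Scheme.{0}) (g : Y ⟶ Spec (.of k)),
    LocallyOfFiniteType g → LocallyTameRootRegular Y → BRExitCover k Y g

/-- **(S1) induced torus** — typed target for provers (ring level, `k`-submodule grading): a tame root chart of finite
type over the perfect field `k` is the degree-`0` part of a SMOOTH finite-type `ℤᵐ`-graded `k`-algebra with homogeneous
units in all degrees `e • χ`, `e ≥ 1` — the input format of `exists_slice`. [OURS · L1 W4.5c] -/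
def InducedTorusStatement : Prop :=
  ∀ (k : Type) [Field k] [PerfectField k] (m : ℕ) (r : Fin m → ℕ) (B : Type) [CommRing B] [Algebra k B]
    [IsNoetherianRing B] [Algebra.FiniteType k B]
    (𝒜 : (Π j : Fin m, ZMod (r j)) → Submodule k B) [GradedAlgebra 𝒜], IsRegularRing B →
    ∀ s : Finset (Π j : Fin m, ZMod (r j)), (∀ d ∈ s, ∃ u : B, IsUnit u ∧ u ∈ 𝒜 d) →
      (AddSubgroup.closure (s : Set (Π j : Fin m, ZMod (r j)))).FiniteIndex →
      ∃ (R : Type) (_ : CommRing R) (_ : Algebra k R) (𝓡 : (Fin m → ℤ) → Submodule k R) (_ : GradedAlgebra 𝓡)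
        (e : ℕ), 0 < e ∧ Algebra.FiniteType k R ∧ Algebra.Smooth k R ∧
        (∀ χ : Fin m → ℤ, ∃ u ∈ 𝓡 (e • χ), IsUnit u) ∧ Nonempty (↥(𝓡 0) ≃ₐ[k] ↥(𝒜 0))

/-- **`stub_tameToBR`, reduced (real proof)**: `TameBRExitCover → ∀ p, p.Prime → GlobalKillTame p → GlobalKillBR p`.
The prime `p` and `p.Prime` are not used (kept for the skeleton's signature). [OURS · L1 W4.5c] -/
theorem globalKillBR_of_globalKillTame (hE : TameBRExitCover) (p : ℕ) (_hp : p.Prime)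
    (hT : GlobalKillTame p) : GlobalKillBR p := by
  intro k _ _ _ X' X₁ f q G _ _ ρ hcard hsep hlft hqc hX₁ hX' hreg hfin hsurj hU hρ horb hdim hinj
  obtain ⟨V, π, hX₁sep, hsepπq, ρB, hπprop, hπbir, hVint, hpin, hequiv, hcov, htame⟩ :=
    hT k X' X₁ f q G ρ hcard hsep hlft hqc hX₁ hX' hreg hfin hsurj hU hρ horb hdim hinj
  haveI := hsep
  haveI := hlft
  haveI := hfin
  haveI := hX₁sep
  haveI := hsepπq
  haveI := hπprop
  haveI : IsLocallyNoetherian X₁ := LocallyOfFiniteType.isLocallyNoetherian f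
  haveI : IsProper (ρB.gluedDesc (π ≫ q) ρB.aut_comp) :=
    ρB.isProper_gluedDesc hcov (π ≫ q) ρB.aut_comp (𝟙 X₁) (Category.comp_id _)
  exact ⟨V, π, hX₁sep, hsepπq, ρB, hπprop, hπbir, hVint, hpin, hequiv, hcov,
    hE k ρB.glued (ρB.gluedDesc (π ≫ q) ρB.aut_comp ≫ f) inferInstance htame⟩

/-- **The skeleton's `stub_tameToBR` VERBATIM under the one remaining hypothesis `TameBRExitCover`** (plan-1
RULING 2026-08-27T19:26:50Z: when line B is registered, `stub_tameToBR` is re-cut to `stub_tameBRExitCover :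
S1.TameBRExitCover` and `CyclicQuotientFourfolds_of` gains one call of this theorem). [OURS · L1 W4.5c] -/
theorem stub_tameToBR_of (hE : TameBRExitCover) : ∀ p : ℕ, p.Prime → GlobalKillTame p → GlobalKillBR p :=
  globalKillBR_of_globalKillTame hE

end Summit.ResolutionOfSingularities.ResolutionOfSingularities.Theorems.WildQuotientResolution.S1.TameToBR

end
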